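import Literature.Analysis.FluidPDE.Wei2016SwirlCriterionProofs
import Literature.Analysis.FluidPDE.Wei2016HardyCutoff
import Literature.Analysis.FluidPDE.Wei2016RayTransfer
import Literature.Analysis.FluidPDE.SereginZajaczkowski2007L42Meridian
import HarnessLib

/-!
# Wei 2016, Lemma 2.3 on `ℝ³`: (2.3) and (2.4) for axisymmetric fields

Analysis/FluidPDE proof file (theorems only) on the way to
`Literature.Analysis.FluidPDE.Wei2016_logModulus_regularity`
(`LeiZhang2017AxisymmetricCriteria.lean`), after

* D. Wei, *Regularity criterion to the axially symmetric Navier–Stokes equations*, J. Math. Anal.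
  Appl. 435 (2016) 402–413 = arXiv:1508.03318, §2, Lemma 2.3:

> **Lemma 2.3.** Assume that `t > 0`, `‖Γ‖_{L^∞(r ≤ r₁)} ≤ ε ≤ 1`, and `0 < r₁ ≤ εK(ε)/a(t)`,
> then `∫ (|u_θ(t)|/r)|f|² dx ≤ ε^{-1/3} ∫ |∂ᵣf|² dx + C (‖Γ‖_{L^∞} + ε^{-1/3})/r₁²
> ∫_{r ≥ r₁/2} |f|² dx` (2.3), `∫ |u_θ(t)|²|f|² dx ≤ ε^{2/3} ∫ |∂ᵣf|² dx
> + C (‖Γ‖²_{L^∞} + ε^{2/3})/r₁² ∫_{r ≥ r₁/2} |f|² dx` (2.4), for all axially symmetric scalar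
> and vector functions `f ∈ H¹`.

This file assembles the three-dimensional statements from the ray forms of
`Wei2016HardyCutoff.lean` (`integral_mul_sq_le_hardy_cutoff`,
`integral_mul_sq_mul_sq_le_hardy_cutoff`) and the transfer lemma of `Wei2016RayTransfer.lean`
(`integral_le_of_forall_ray_le`, `dx = r dr dθ dz`):

* profiles along the meridian half-plane: `apply_zero_one_eq_zero_of_axis` (horizontal
  components of an axisymmetric field vanish on the axis), `swirlVelocity_meridianPoint`,
  `abs_swirlVelocity_meridianPoint` (`|u_θ(ρ, 0, z)| = |u₁(ρ, 0, z)|` along the whole line),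
  `swirl_meridianPoint` (`Γ = ρ u₁`), `isAxisymmetricScalar_swirlVelocity`,
  `partialDeriv_eR_meridianPoint` (`∂ᵣF = DF[e₀]` at `(ρ, 0, z)`, `ρ > 0`);
* `Wei2016.integral_abs_swirlVelocity_div_mul_sq_le` — **(2.3) on `ℝ³`** for a continuous
  axisymmetric field `u` and an axisymmetric `C¹` scalar `F` (scalar case of the printed `f`;
  vector `f` componentwise), with the constant in the general form
  `M = ε(1 + ln K + ½ (ln K)²)`, `K ≥ 1`, `r₁ ≤ εK/a` (`M = ε^{-1/3}` for `K = K(ε)`,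
  `Wei2016.one_add_log_K_add_sq_div_two`), the absolute constant `C = Wei2016.hardyConst`, the
  region `{r > r₁/2}` (equal to the printed `{r ≥ r₁/2}` up to a null set) and `Γ_∞` any bound of
  `|Γ|` (e.g. `‖Γ‖_{L^∞}`); the hypothesis `a ≥ a(t)` is asked only on `r ≤ r₁`
  (`∫₀ʳ |u_θ(s, 0, z)| ds ≤ r a` for `0 < r ≤ r₁`), which is all the printed proof uses;
* `Wei2016.integral_swirlVelocity_sq_mul_sq_le` — **(2.4) on `ℝ³`** likewise (`εM = ε^{2/3}`).

Integrability of the three integrands is assumed (for the paper's `f ∈ H¹` and bounded `u_θ/r`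
it holds); no limits in `R` are needed beyond `integral_le_of_forall_ray_le`.

## References

* D. Wei, J. Math. Anal. Appl. 435 (2016) 402–413, arXiv:1508.03318, Lemma 2.3 ((2.3)–(2.4)).
  [Wei2016]
-/

noncomputable section

open MeasureTheory Set Function Filter Topology TopologicalSpace Metric intervalIntegral
open scoped ENNReal RealInnerProductSpace

namespace Literature.Analysis.FluidPDE

namespace Wei2016

/-! ### Profiles of axisymmetric fields along the meridian half-plane -/

/-- The horizontal components of an axisymmetric field vanish on the axis (rotate by `π`:
`u x = R_π (u x)` for `x` on the axis). [folklore] -/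
theorem apply_zero_one_eq_zero_of_axis {u : EuclideanSpace ℝ (Fin 3) → EuclideanSpace ℝ (Fin 3)}
    (hu : IsAxisymmetric u) {x : EuclideanSpace ℝ (Fin 3)} (h0 : x 0 = 0) (h1 : x 1 = 0) :
    u x 0 = 0 ∧ u x 1 = 0 := by
  have hfix : rotZ Real.pi x = x := by
    ext i
    fin_cases i <;> simp [rotZ, h0, h1]
  have h := hu Real.pi x
  rw [hfix] at h
  have e0 := congrArg (fun v => v 0) h
  have e1 := congrArg (fun v => v 1) h
  simp only [rotZ_apply_zero, rotZ_apply_one, Real.cos_pi, Real.sin_pi, zero_mul, sub_zero,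
    neg_mul, one_mul, zero_add] at e0 e1
  constructor <;> linarith

/-- At a meridian point `(ρ, 0, z)`, `ρ > 0`, the swirl velocity is the `x₁`-component:
`u_θ = u₁`. [folklore] -/
theorem swirlVelocity_meridianPoint (u : EuclideanSpace ℝ (Fin 3) → EuclideanSpace ℝ (Fin 3))
    {ρ : ℝ} (hρ : 0 < ρ) (z : ℝ) :
    swirlVelocity u (meridianPoint (ρ, z)) = u (meridianPoint (ρ, z)) 1 := by
  rw [swirlVelocity, SereginZajaczkowski2007.eTheta_meridianPoint (show (0 : ℝ) < (ρ, z).1 from hρ)]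
  simp [PiLp.inner_apply]

/-- Along the whole meridian line, `|u_θ(ρ, 0, z)| = |u₁(ρ, 0, z)|` for an axisymmetric field
(`e_θ = ±e₁` off the axis, both sides vanish on the axis). [folklore] -/
theorem abs_swirlVelocity_meridianPoint {u : EuclideanSpace ℝ (Fin 3) → EuclideanSpace ℝ (Fin 3)}
    (hu : IsAxisymmetric u) (ρ z : ℝ) :
    |swirlVelocity u (meridianPoint (ρ, z))| = |u (meridianPoint (ρ, z)) 1| := by
  rcases lt_trichotomy ρ 0 with hneg | rfl | hpos
  · have hr : cylRadius (meridianPoint (ρ, z)) = -ρ := by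
      rw [cylRadius_meridianPoint_eq_abs, abs_of_neg hneg]
    have : swirlVelocity u (meridianPoint (ρ, z)) = -u (meridianPoint (ρ, z)) 1 := by
      rw [swirlVelocity, eTheta, hr]
      simp [PiLp.inner_apply, Fin.sum_univ_three, meridianPoint, hneg.ne]
    rw [this, abs_neg]
  · have hax := apply_zero_one_eq_zero_of_axis hu (x := meridianPoint (0, z)) rfl rfl
    have hr : cylRadius (meridianPoint ((0 : ℝ), z)) = 0 := by
      rw [cylRadius_meridianPoint_eq_abs, abs_zero]
    have : swirlVelocity u (meridianPoint (0, z)) = 0 := by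
      simp [swirlVelocity, eTheta, hr]
    rw [this, hax.2, abs_zero]
  · rw [swirlVelocity_meridianPoint u hpos z]

/-- At a meridian point the swirl is `Γ(ρ, 0, z) = ρ u₁(ρ, 0, z)`. [folklore] -/
theorem swirl_meridianPoint (u : EuclideanSpace ℝ (Fin 3) → EuclideanSpace ℝ (Fin 3)) (ρ z : ℝ) :
    swirl u (meridianPoint (ρ, z)) = ρ * u (meridianPoint (ρ, z)) 1 := by
  simp [swirl, meridianPoint]

/-- The swirl velocity of an axisymmetric field is an axisymmetric scalar
(`e_θ(R_θ x) = R_θ e_θ(x)` and rotations preserve inner products). [folklore] -/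
theorem isAxisymmetricScalar_swirlVelocity {u : EuclideanSpace ℝ (Fin 3) → EuclideanSpace ℝ (Fin 3)}
    (hu : IsAxisymmetric u) : IsAxisymmetricScalar (swirlVelocity u) := by
  intro θ x
  rw [swirlVelocity, swirlVelocity, hu θ x, SereginZajaczkowski2007.eTheta_rotZ,
    SereginZajaczkowski2007.inner_rotZ_rotZ]

/-- At a meridian point `(ρ, 0, z)`, `ρ > 0`, the radial derivative is the derivative along
`e₀`: `∂ᵣF = DF[e₀]`. [folklore] -/
theorem partialDeriv_eR_meridianPoint (F : EuclideanSpace ℝ (Fin 3) → ℝ) {ρ : ℝ} (hρ : 0 < ρ)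
    (z : ℝ) :
    partialDeriv (eR (meridianPoint (ρ, z))) F (meridianPoint (ρ, z)) =
      fderiv ℝ F (meridianPoint (ρ, z)) (EuclideanSpace.single 0 (1 : ℝ)) := by
  rw [partialDeriv, eR_meridianPoint hρ z]

/-! ### Lemma 2.3 on `ℝ³` -/

/-- **Wei 2016, Lemma 2.3, (2.3), on `ℝ³`.** Let `u` be a continuous axisymmetric field and `F`
an axisymmetric `C¹` scalar with `(|u_θ|/r) F²`, `(∂ᵣF)²`, `F²` integrable. Assume
`‖Γ‖_{L^∞(r ≤ r₁)} ≤ ε` (`|Γ(x)| ≤ ε` for `0 < r(x) ≤ r₁`), `|Γ| ≤ Γ_∞` everywhere, `0 < ε`, `0 < a`,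
`1 ≤ K`, `0 < r₁ ≤ εK/a`, and `v(r, z) = ∫₀ʳ |u_θ| ≤ r a` for `0 < r ≤ r₁` (i.e. `a ≥ a(t)` on
`r ≤ r₁`). Then, with `M = ε(1 + ln K + ½ (ln K)²)` (`= ε^{-1/3}` for `K = K(ε)`) and the absolute
constant `C = hardyConst`,
`∫ (|u_θ|/r) F² dx ≤ M ∫ (∂ᵣF)² dx + C (Γ_∞ + M)/r₁² ∫_{r > r₁/2} F² dx`.
Proof: ray by ray (`integral_mul_sq_le_hardy_cutoff` for the profiles `|u₁(ρ, 0, z)|`,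
`F(ρ, 0, z)`), then `integral_le_of_forall_ray_le` (`dx = r dr dθ dz`).
[cite: Wei2016, Lemma 2.3, (2.3)] -/
theorem integral_abs_swirlVelocity_div_mul_sq_le
    {u : EuclideanSpace ℝ (Fin 3) → EuclideanSpace ℝ (Fin 3)} {F : EuclideanSpace ℝ (Fin 3) → ℝ}
    {ε a K r₁ Γb : ℝ} (hu : IsAxisymmetric u) (huc : Continuous u) (hF : IsAxisymmetricScalar F)
    (hFd : ContDiff ℝ 1 F) (hε : 0 < ε) (ha : 0 < a) (hK : 1 ≤ K) (hr₁ : 0 < r₁)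
    (hr₁K : r₁ ≤ ε * K / a)
    (hΓε : ∀ x, 0 < cylRadius x → cylRadius x ≤ r₁ → |swirl u x| ≤ ε)
    (hΓb : ∀ x, |swirl u x| ≤ Γb)
    (hv : ∀ z r : ℝ, 0 < r → r ≤ r₁ →
      ∫ s in (0 : ℝ)..r, |swirlVelocity u (meridianPoint (s, z))| ≤ r * a)
    (hAi : Integrable fun x => |swirlVelocity u x| / cylRadius x * F x ^ 2)
    (hBi : Integrable fun x => partialDeriv (eR x) F x ^ 2)
    (hCi : Integrable fun x => F x ^ 2) :
    ∫ x, |swirlVelocity u x| / cylRadius x * F x ^ 2 ≤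
      ε * (1 + Real.log K + Real.log K ^ 2 / 2) * (∫ x, partialDeriv (eR x) F x ^ 2) +
        hardyConst * (Γb + ε * (1 + Real.log K + Real.log K ^ 2 / 2)) / r₁ ^ 2 *
          ∫ x in {x | r₁ / 2 < cylRadius x}, F x ^ 2 := by
  have hFdiff : Differentiable ℝ F := hFd.differentiable one_ne_zero
  have hFc : Continuous F := hFd.continuous
  have hDFc : Continuous (fderiv ℝ F) := hFd.continuous_fderiv one_ne_zero
  -- axisymmetry of the three integrands
  have hsv : IsAxisymmetricScalar (swirlVelocity u) := isAxisymmetricScalar_swirlVelocity hu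
  have hAa : IsAxisymmetricScalar fun x => |swirlVelocity u x| / cylRadius x * F x ^ 2 := by
    intro θ x
    simp only [hsv θ x, cylRadius_rotZ, hF θ x]
  have hBa : IsAxisymmetricScalar fun x => partialDeriv (eR x) F x ^ 2 := by
    intro θ x
    have h : fderiv ℝ F (rotZ θ x) (eR (rotZ θ x)) = fderiv ℝ F x (eR x) :=
      hF.fderiv_apply_eR hFdiff θ x
    simp only [partialDeriv, h]
  have hCa : IsAxisymmetricScalar fun x => F x ^ 2 := fun θ x => by simp only [hF θ x]
  refine integral_le_of_forall_ray_le (R₀ := r₁) (c₀ := r₁ / 2) hAa hBa hCa hAi hBi hCi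
    (by positivity) fun z R hR => ?_
  -- the profiles along the ray at height `z`
  set w : ℝ → ℝ := fun ρ => |u (meridianPoint (ρ, z)) 1| with hw
  set f : ℝ → ℝ := fun ρ => F (meridianPoint (ρ, z)) with hf
  set f' : ℝ → ℝ := fun ρ => fderiv ℝ F (meridianPoint (ρ, z)) (EuclideanSpace.single 0 (1 : ℝ))
    with hf'
  have hmpc : Continuous fun ρ : ℝ => meridianPoint (ρ, z) :=
    (contDiff_meridianPoint (n := 0)).continuous.comp (continuous_id.prodMk continuous_const)
  have hwc : Continuous w := by
    have h1 : Continuous fun ρ : ℝ => u (meridianPoint (ρ, z)) := huc.comp hmpc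
    have h2 : Continuous fun ρ : ℝ => (u (meridianPoint (ρ, z))) 1 :=
      (EuclideanSpace.proj (1 : Fin 3)).continuous.comp h1
    exact h2.abs
  have hw0 : ∀ ρ, 0 ≤ w ρ := fun ρ => abs_nonneg _
  have hfd : ∀ ρ, HasDerivAt f (f' ρ) ρ := fun ρ =>
    hasDerivAt_comp_meridianPoint_fst z (hFdiff _)
  have hf'c : Continuous f' := by
    simp only [hf']
    exact (hDFc.comp hmpc).clm_apply continuous_const
  -- the hypotheses of the ray lemma
  have hwε : ∀ ρ ∈ Ioc 0 r₁, w ρ ≤ ε / ρ := by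
    intro ρ hρ
    have hx : cylRadius (meridianPoint (ρ, z)) = ρ := by
      rw [cylRadius_meridianPoint_eq_abs, abs_of_pos hρ.1]
    have h := hΓε (meridianPoint (ρ, z)) (by rw [hx]; exact hρ.1) (by rw [hx]; exact hρ.2)
    rw [swirl_meridianPoint, abs_mul, abs_of_pos hρ.1] at h
    rw [le_div_iff₀ hρ.1, mul_comm]
    exact h
  have hV : ∀ ρ ∈ Ioc 0 r₁, ∫ s in (0 : ℝ)..ρ, w s ≤ ρ * a := by
    intro ρ hρ
    have h := hv z ρ hρ.1 hρ.2
    have e : ∫ s in (0 : ℝ)..ρ, |swirlVelocity u (meridianPoint (s, z))| = ∫ s in (0 : ℝ)..ρ, w s :=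
      intervalIntegral.integral_congr fun s _ => abs_swirlVelocity_meridianPoint hu s z
    rwa [e] at h
  have hΓ : ∀ ρ, 0 < ρ → ρ * w ρ ≤ Γb := by
    intro ρ hρ
    have h := hΓb (meridianPoint (ρ, z))
    rwa [swirl_meridianPoint, abs_mul, abs_of_pos hρ] at h
  have hray := integral_mul_sq_le_hardy_cutoff hε ha hK hr₁ hr₁K hR hwc hw0 hwε hV hΓ hfd hf'c
  -- identify the ray integrals with the profiles of the three integrands
  have hRpos : 0 < R := hr₁.trans_le hR
  have eA : ∫ ρ in (0 : ℝ)..R, ρ * (|swirlVelocity u (meridianPoint (ρ, z))| /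
      cylRadius (meridianPoint (ρ, z)) * F (meridianPoint (ρ, z)) ^ 2) =
      ∫ ρ in (0 : ℝ)..R, w ρ * f ρ ^ 2 := by
    refine intervalIntegral.integral_congr fun ρ hρ => ?_
    rw [uIcc_of_le hRpos.le] at hρ
    simp only [hw, hf]
    rw [abs_swirlVelocity_meridianPoint hu ρ z, cylRadius_meridianPoint_eq_abs, abs_of_nonneg hρ.1]
    rcases hρ.1.eq_or_lt with h0 | hpos
    · rw [← h0]
      have hax := apply_zero_one_eq_zero_of_axis hu (x := meridianPoint (0, z)) rfl rfl
      simp [hax.2]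
    · field_simp
  have eB : ∫ ρ in (0 : ℝ)..R,
      ρ * partialDeriv (eR (meridianPoint (ρ, z))) F (meridianPoint (ρ, z)) ^ 2 =
      ∫ ρ in (0 : ℝ)..R, ρ * f' ρ ^ 2 := by
    refine intervalIntegral.integral_congr fun ρ hρ => ?_
    rw [uIcc_of_le hRpos.le] at hρ
    rcases hρ.1.eq_or_lt with h0 | hpos
    · simp [← h0]
    · simp only [hf']
      rw [partialDeriv_eR_meridianPoint F hpos z]
  have eC : ∫ ρ in (r₁ / 2)..R, ρ * F (meridianPoint (ρ, z)) ^ 2 =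
      ∫ ρ in (r₁ / 2)..R, f ρ ^ 2 * ρ := by
    refine intervalIntegral.integral_congr fun ρ _ => ?_
    simp only [hf]
    ring
  rw [eA, eB, eC]
  exact hray

/-- **Wei 2016, Lemma 2.3, (2.4), on `ℝ³`.** Under the hypotheses of
`integral_abs_swirlVelocity_div_mul_sq_le` (with `u_θ² F²` integrable instead),
`∫ u_θ² F² dx ≤ εM ∫ (∂ᵣF)² dx + C (Γ_∞² + εM)/r₁² ∫_{r > r₁/2} F² dx` (`εM = ε^{2/3}` for
`K = K(ε)`). [cite: Wei2016, Lemma 2.3, (2.4)] -/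
theorem integral_swirlVelocity_sq_mul_sq_le
    {u : EuclideanSpace ℝ (Fin 3) → EuclideanSpace ℝ (Fin 3)} {F : EuclideanSpace ℝ (Fin 3) → ℝ}
    {ε a K r₁ Γb : ℝ} (hu : IsAxisymmetric u) (huc : Continuous u) (hF : IsAxisymmetricScalar F)
    (hFd : ContDiff ℝ 1 F) (hε : 0 < ε) (ha : 0 < a) (hK : 1 ≤ K) (hr₁ : 0 < r₁)
    (hr₁K : r₁ ≤ ε * K / a)
    (hΓε : ∀ x, 0 < cylRadius x → cylRadius x ≤ r₁ → |swirl u x| ≤ ε)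
    (hΓb : ∀ x, |swirl u x| ≤ Γb)
    (hv : ∀ z r : ℝ, 0 < r → r ≤ r₁ →
      ∫ s in (0 : ℝ)..r, |swirlVelocity u (meridianPoint (s, z))| ≤ r * a)
    (hAi : Integrable fun x => swirlVelocity u x ^ 2 * F x ^ 2)
    (hBi : Integrable fun x => partialDeriv (eR x) F x ^ 2)
    (hCi : Integrable fun x => F x ^ 2) :
    ∫ x, swirlVelocity u x ^ 2 * F x ^ 2 ≤
      ε * (ε * (1 + Real.log K + Real.log K ^ 2 / 2)) * (∫ x, partialDeriv (eR x) F x ^ 2) +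
        hardyConst * (Γb ^ 2 + ε * (ε * (1 + Real.log K + Real.log K ^ 2 / 2))) / r₁ ^ 2 *
          ∫ x in {x | r₁ / 2 < cylRadius x}, F x ^ 2 := by
  have hFdiff : Differentiable ℝ F := hFd.differentiable one_ne_zero
  have hDFc : Continuous (fderiv ℝ F) := hFd.continuous_fderiv one_ne_zero
  have hsv : IsAxisymmetricScalar (swirlVelocity u) := isAxisymmetricScalar_swirlVelocity hu
  have hAa : IsAxisymmetricScalar fun x => swirlVelocity u x ^ 2 * F x ^ 2 := by
    intro θ x
    simp only [hsv θ x, hF θ x]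
  have hBa : IsAxisymmetricScalar fun x => partialDeriv (eR x) F x ^ 2 := by
    intro θ x
    have h : fderiv ℝ F (rotZ θ x) (eR (rotZ θ x)) = fderiv ℝ F x (eR x) :=
      hF.fderiv_apply_eR hFdiff θ x
    simp only [partialDeriv, h]
  have hCa : IsAxisymmetricScalar fun x => F x ^ 2 := fun θ x => by simp only [hF θ x]
  refine integral_le_of_forall_ray_le (R₀ := r₁) (c₀ := r₁ / 2) hAa hBa hCa hAi hBi hCi
    (by positivity) fun z R hR => ?_
  set w : ℝ → ℝ := fun ρ => |u (meridianPoint (ρ, z)) 1| with hw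
  set f : ℝ → ℝ := fun ρ => F (meridianPoint (ρ, z)) with hf
  set f' : ℝ → ℝ := fun ρ => fderiv ℝ F (meridianPoint (ρ, z)) (EuclideanSpace.single 0 (1 : ℝ))
    with hf'
  have hmpc : Continuous fun ρ : ℝ => meridianPoint (ρ, z) :=
    (contDiff_meridianPoint (n := 0)).continuous.comp (continuous_id.prodMk continuous_const)
  have hwc : Continuous w := by
    have h1 : Continuous fun ρ : ℝ => u (meridianPoint (ρ, z)) := huc.comp hmpc
    have h2 : Continuous fun ρ : ℝ => (u (meridianPoint (ρ, z))) 1 :=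
      (EuclideanSpace.proj (1 : Fin 3)).continuous.comp h1
    exact h2.abs
  have hw0 : ∀ ρ, 0 ≤ w ρ := fun ρ => abs_nonneg _
  have hfd : ∀ ρ, HasDerivAt f (f' ρ) ρ := fun ρ =>
    hasDerivAt_comp_meridianPoint_fst z (hFdiff _)
  have hf'c : Continuous f' := by
    simp only [hf']
    exact (hDFc.comp hmpc).clm_apply continuous_const
  have hwε : ∀ ρ ∈ Ioc 0 r₁, w ρ ≤ ε / ρ := by
    intro ρ hρ
    have hx : cylRadius (meridianPoint (ρ, z)) = ρ := by
      rw [cylRadius_meridianPoint_eq_abs, abs_of_pos hρ.1]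
    have h := hΓε (meridianPoint (ρ, z)) (by rw [hx]; exact hρ.1) (by rw [hx]; exact hρ.2)
    rw [swirl_meridianPoint, abs_mul, abs_of_pos hρ.1] at h
    rw [le_div_iff₀ hρ.1, mul_comm]
    exact h
  have hV : ∀ ρ ∈ Ioc 0 r₁, ∫ s in (0 : ℝ)..ρ, w s ≤ ρ * a := by
    intro ρ hρ
    have h := hv z ρ hρ.1 hρ.2
    have e : ∫ s in (0 : ℝ)..ρ, |swirlVelocity u (meridianPoint (s, z))| = ∫ s in (0 : ℝ)..ρ, w s :=
      intervalIntegral.integral_congr fun s _ => abs_swirlVelocity_meridianPoint hu s z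
    rwa [e] at h
  have hΓ : ∀ ρ, 0 < ρ → ρ * w ρ ≤ Γb := by
    intro ρ hρ
    have h := hΓb (meridianPoint (ρ, z))
    rwa [swirl_meridianPoint, abs_mul, abs_of_pos hρ] at h
  have hray := integral_mul_sq_mul_sq_le_hardy_cutoff hε ha hK hr₁ hr₁K hR hwc hw0 hwε hV hΓ hfd
    hf'c
  have hRpos : 0 < R := hr₁.trans_le hR
  have eA : ∫ ρ in (0 : ℝ)..R, ρ * (swirlVelocity u (meridianPoint (ρ, z)) ^ 2 *
      F (meridianPoint (ρ, z)) ^ 2) = ∫ ρ in (0 : ℝ)..R, ρ * w ρ ^ 2 * f ρ ^ 2 := by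
    refine intervalIntegral.integral_congr fun ρ _ => ?_
    simp only [hw, hf]
    rw [← sq_abs (swirlVelocity u _), abs_swirlVelocity_meridianPoint hu ρ z]
    ring
  have eB : ∫ ρ in (0 : ℝ)..R,
      ρ * partialDeriv (eR (meridianPoint (ρ, z))) F (meridianPoint (ρ, z)) ^ 2 =
      ∫ ρ in (0 : ℝ)..R, ρ * f' ρ ^ 2 := by
    refine intervalIntegral.integral_congr fun ρ hρ => ?_
    rw [uIcc_of_le hRpos.le] at hρ
    rcases hρ.1.eq_or_lt with h0 | hpos
    · simp [← h0]
    · simp only [hf']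
      rw [partialDeriv_eR_meridianPoint F hpos z]
  have eC : ∫ ρ in (r₁ / 2)..R, ρ * F (meridianPoint (ρ, z)) ^ 2 =
      ∫ ρ in (r₁ / 2)..R, f ρ ^ 2 * ρ := by
    refine intervalIntegral.integral_congr fun ρ _ => ?_
    simp only [hf]
    ring
  rw [eA, eB, eC]
  exact hray


/-! ### The constants for Wei's `K(ε)`: `M = ε^{-1/3}`, `εM = ε^{2/3}` -/

/-- `K(ε) ≥ 1` for `0 < ε ≤ 1` (`ln K(ε) = √(2ε^{-4/3} − 1) − 1 ≥ 0`). [cite: Wei2016, §1 (definition of K)] -/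
theorem one_le_K {ε : ℝ} (hε : 0 < ε) (hε1 : ε ≤ 1) : 1 ≤ K ε := by
  have h1 : 1 ≤ ε ^ (-(4 / 3 : ℝ)) := Real.one_le_rpow_of_pos_of_le_one_of_nonpos hε hε1 (by norm_num)
  have h2 : 1 ≤ Real.sqrt (2 * ε ^ (-(4 / 3 : ℝ)) - 1) := by
    rw [Real.le_sqrt' one_pos]
    linarith
  have h3 : 0 ≤ Real.sqrt (2 * ε ^ (-(4 / 3 : ℝ)) - 1) - 1 := by linarith
  rw [K]
  exact Real.one_le_exp h3

/-- **`ε(1 + ln K(ε) + ½ (ln K(ε))²) = ε^{-1/3}`** — the constant of (2.3)/(2.5) for Wei's `K`.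
[cite: Wei2016, proof of Lemma 2.3, (2.8)] -/
theorem eps_mul_one_add_log_K {ε : ℝ} (hε : 0 < ε) (hε1 : ε ≤ 1) :
    ε * (1 + Real.log (K ε) + Real.log (K ε) ^ 2 / 2) = ε ^ (-(1 / 3 : ℝ)) := by
  rw [one_add_log_K_add_sq_div_two hε hε1,
    show ε * ε ^ (-(4 / 3 : ℝ)) = ε ^ (1 : ℝ) * ε ^ (-(4 / 3 : ℝ)) by rw [Real.rpow_one],
    ← Real.rpow_add hε]
  norm_num

/-- **`ε · ε^{-1/3} = ε^{2/3}`** — the constant of (2.4). [cite: Wei2016, Lemma 2.3, (2.4)] -/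
theorem eps_mul_eps_mul_one_add_log_K {ε : ℝ} (hε : 0 < ε) (hε1 : ε ≤ 1) :
    ε * (ε * (1 + Real.log (K ε) + Real.log (K ε) ^ 2 / 2)) = ε ^ (2 / 3 : ℝ) := by
  rw [eps_mul_one_add_log_K hε hε1,
    show ε * ε ^ (-(1 / 3 : ℝ)) = ε ^ (1 : ℝ) * ε ^ (-(1 / 3 : ℝ)) by rw [Real.rpow_one],
    ← Real.rpow_add hε]
  norm_num

/-- **(2.3) on `ℝ³` with Wei's `K(ε)`**: under `0 < ε ≤ 1`, `0 < r₁ ≤ εK(ε)/a` and the hypotheses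
of `integral_abs_swirlVelocity_div_mul_sq_le`,
`∫ (|u_θ|/r) F² dx ≤ ε^{-1/3} ∫ (∂ᵣF)² dx + C (Γ_∞ + ε^{-1/3})/r₁² ∫_{r > r₁/2} F² dx`.
[cite: Wei2016, Lemma 2.3, (2.3)] -/
theorem integral_abs_swirlVelocity_div_mul_sq_le_K
    {u : EuclideanSpace ℝ (Fin 3) → EuclideanSpace ℝ (Fin 3)} {F : EuclideanSpace ℝ (Fin 3) → ℝ}
    {ε a r₁ Γb : ℝ} (hu : IsAxisymmetric u) (huc : Continuous u) (hF : IsAxisymmetricScalar F)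
    (hFd : ContDiff ℝ 1 F) (hε : 0 < ε) (hε1 : ε ≤ 1) (ha : 0 < a) (hr₁ : 0 < r₁)
    (hr₁K : r₁ ≤ ε * K ε / a)
    (hΓε : ∀ x, 0 < cylRadius x → cylRadius x ≤ r₁ → |swirl u x| ≤ ε)
    (hΓb : ∀ x, |swirl u x| ≤ Γb)
    (hv : ∀ z r : ℝ, 0 < r → r ≤ r₁ →
      ∫ s in (0 : ℝ)..r, |swirlVelocity u (meridianPoint (s, z))| ≤ r * a)
    (hAi : Integrable fun x => |swirlVelocity u x| / cylRadius x * F x ^ 2)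
    (hBi : Integrable fun x => partialDeriv (eR x) F x ^ 2)
    (hCi : Integrable fun x => F x ^ 2) :
    ∫ x, |swirlVelocity u x| / cylRadius x * F x ^ 2 ≤
      ε ^ (-(1 / 3 : ℝ)) * (∫ x, partialDeriv (eR x) F x ^ 2) +
        hardyConst * (Γb + ε ^ (-(1 / 3 : ℝ))) / r₁ ^ 2 * ∫ x in {x | r₁ / 2 < cylRadius x}, F x ^ 2 := by
  have h := integral_abs_swirlVelocity_div_mul_sq_le hu huc hF hFd hε ha (one_le_K hε hε1) hr₁ hr₁K
    hΓε hΓb hv hAi hBi hCi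
  rwa [eps_mul_one_add_log_K hε hε1] at h

/-- **(2.4) on `ℝ³` with Wei's `K(ε)`**:
`∫ u_θ² F² dx ≤ ε^{2/3} ∫ (∂ᵣF)² dx + C (Γ_∞² + ε^{2/3})/r₁² ∫_{r > r₁/2} F² dx`.
[cite: Wei2016, Lemma 2.3, (2.4)] -/
theorem integral_swirlVelocity_sq_mul_sq_le_K
    {u : EuclideanSpace ℝ (Fin 3) → EuclideanSpace ℝ (Fin 3)} {F : EuclideanSpace ℝ (Fin 3) → ℝ}
    {ε a r₁ Γb : ℝ} (hu : IsAxisymmetric u) (huc : Continuous u) (hF : IsAxisymmetricScalar F)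
    (hFd : ContDiff ℝ 1 F) (hε : 0 < ε) (hε1 : ε ≤ 1) (ha : 0 < a) (hr₁ : 0 < r₁)
    (hr₁K : r₁ ≤ ε * K ε / a)
    (hΓε : ∀ x, 0 < cylRadius x → cylRadius x ≤ r₁ → |swirl u x| ≤ ε)
    (hΓb : ∀ x, |swirl u x| ≤ Γb)
    (hv : ∀ z r : ℝ, 0 < r → r ≤ r₁ →
      ∫ s in (0 : ℝ)..r, |swirlVelocity u (meridianPoint (s, z))| ≤ r * a)
    (hAi : Integrable fun x => swirlVelocity u x ^ 2 * F x ^ 2)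
    (hBi : Integrable fun x => partialDeriv (eR x) F x ^ 2)
    (hCi : Integrable fun x => F x ^ 2) :
    ∫ x, swirlVelocity u x ^ 2 * F x ^ 2 ≤
      ε ^ (2 / 3 : ℝ) * (∫ x, partialDeriv (eR x) F x ^ 2) +
        hardyConst * (Γb ^ 2 + ε ^ (2 / 3 : ℝ)) / r₁ ^ 2 * ∫ x in {x | r₁ / 2 < cylRadius x}, F x ^ 2 := by
  have h := integral_swirlVelocity_sq_mul_sq_le hu huc hF hFd hε ha (one_le_K hε hε1) hr₁ hr₁K hΓε
    hΓb hv hAi hBi hCi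
  rwa [eps_mul_eps_mul_one_add_log_K hε hε1] at h


end Wei2016

end Literature.Analysis.FluidPDE

end
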